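import Literature.Geometry.Lorentzian.CoordEntropyFormula
import HarnessLib

/-!
# The Bakry–Émery computation in coordinates: the weighted Bochner formula and the pointwise
# dissipation identity of the Fisher information along the weighted heat flow

A further layer of the coordinate tensor calculus (`CoordBochner`, `CoordEntropyEvolution`,
`CoordEntropyFormula`): metric components `G` on an open set `V ⊆ E` (`IsMetricOn G V`, a
STATIC metric), a smooth weight `W : E → ℝ` (the weighted / Witten Laplacian
`L φ = Δφ − ⟨∇W, ∇φ⟩ = lapAt G φ − Dφ(♯DW)` and the Bakry–Émery tensor `Ric_W = Ric + Hess W`),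
and a time-dependent function `f : ℝ → E → ℝ`, `C^∞` on `V × S`. This is the computation
displayed in Carrillo–Ni (Comm. Anal. Geom. 17 (2009), arXiv:0806.2417), §3, p. 8 —
"`∂_t|∇ξ|² − Δ|∇ξ|² = −2ξ_{ij}² + 2⟨∇⟨∇ξ, ∇log ρ⟩, ∇ξ⟩ − 2R_{ij}ξ_iξ_j`" leading to
"`d/dt I_V(ρ(t)) = ∫ (−2ξ_{ij}² − 2(R_{ij} + V_{ij})ξ_iξ_j) ρ dΓ`", the Bakry–Émery strategy
(Bakry–Émery 1985) — organised as pointwise identities: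

* `IsMetricOn.hasFDerivAt_innerGrad`, `fderiv_innerGrad` —
  **`∂_Y ⟨∇f, ∇W⟩ = Hess f(Y, ∇W) + Hess W(Y, ∇f)`** (metric compatibility; the case `W = f` is
  `fderiv_gradSqAt` of `CoordBochner.lean`);
* `IsMetricOn.weightedLapAt_gradSqAt` — **the weighted Bochner formula**
  `L|∇f|² = 2|Hess f|² + 2⟨∇f, ∇Lf⟩ + 2 Ric_W(∇f, ∇f)` (from the Bochner formula
  `IsMetricOn.lapAt_gradSqAt`);
* `IsMetricOn.isMetricFamilyOn_const`, `hasDerivWithinAt_gradSqAt_static` — for a static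
  metric, `∂_t |∇f_t|² = 2 Dḟ(♯Df)`;
* `IsMetricOn.fisher_identity` — **the dissipation identity**: where `f` solves
  `ḟ = Lf − |∇f|²` on `V` at time `t` (the equation of `f = −log u` for a positive solution `u`
  of the weighted heat equation `u̇ = Lu`),
  `∂_t|∇f|² − L|∇f|² + 2⟨∇f, ∇|∇f|²⟩ = −2|Hess f|² − 2 Ric_W(∇f, ∇f)`.

Integrated against `u e^{-W} dvol` (where the `L`- and `⟨∇f, ∇·⟩`-terms cancel by the
symmetry of `L`), the last identity is `d/dt I = −2∫ (|Hess f|² + Ric_W(∇f,∇f)) u dm ≤ −2K I`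
under `Ric_W ≥ K G` (Carrillo–Ni, loc. cit.), the heart of the Bakry–Émery theorem; that
integration is carried out on the manifold in `Literature/Geometry/Riemannian/BakryEmeryHeatFlow.lean`.
Everything is by the Fréchet calculus of the previous layers; everything is proved; no
definitions and no statements of `Prop` type are introduced.

## References

* J. A. Carrillo, L. Ni, *Sharp logarithmic Sobolev inequalities on gradient solitons and
  applications*, Comm. Anal. Geom. 17 (2009) 721–753 (arXiv:0806.2417), §3, (3.2)–(3.4) and
  the displayed computation of `d/dt I_V` (p. 8 of the arXiv text). [CarrilloNi2009]
* D. Bakry, M. Émery, *Diffusions hypercontractives*, Sém. Probab. XIX, LNM 1123 (1985)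
  177–206. [BakryEmery1985]
* P. Topping, *Lectures on the Ricci flow*, LMS LNS 325 (2006), proof of Prop. 8.2.6 (Bochner
  formula). [Topping2006]
-/

noncomputable section

set_option maxSynthPendingDepth 3

open Set Filter ContinuousLinearMap Module
open scoped Topology ContDiff

namespace Literature.Geometry.Lorentzian

namespace MetricCoord

variable {E : Type*} [NormedAddCommGroup E] [NormedSpace ℝ E] [FiniteDimensional ℝ E]
  [CompleteSpace E] {G : E → E →L[ℝ] E →L[ℝ] ℝ} {V : Set E} {x : E}

/-! ### Two identities for `♯` -/

section Sharp

omit [FiniteDimensional ℝ E] [CompleteSpace E]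

/-- For symmetric invertible `G x`: `α(♯β) = β(♯α)`. [folklore] -/
theorem apply_sharpAt_comm (hx : (G x).IsInvertible) (hs : ∀ v w : E, G x v w = G x w v)
    (α β : E →L[ℝ] ℝ) : α (sharpAt G x β) = β (sharpAt G x α) := by
  rw [← apply_sharpAt_apply hx α (sharpAt G x β), hs, apply_sharpAt_apply hx]

/-- `G(♯α, ♯α) = α(♯α)` (the gradient square as a squared length). [folklore] -/
theorem apply_sharpAt_sharpAt (hx : (G x).IsInvertible) (α : E →L[ℝ] ℝ) :
    G x (sharpAt G x α) (sharpAt G x α) = α (sharpAt G x α) := by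
  rw [apply_sharpAt_apply hx]

end Sharp

/-! ### `∂_Y ⟨∇f, ∇W⟩ = Hess f (Y, ∇W) + Hess W (Y, ∇f)` -/

section InnerGrad

variable {f W : E → ℝ}

omit [FiniteDimensional ℝ E] in
/-- **The differential of the pairing of two gradients**: for `C^∞` functions `f, W` on `V`,
`y ↦ ⟨∇f, ∇W⟩_G (y) = Df_y(♯ DW_y)` has derivative
`Y ↦ Hess f_x(Y, ♯DW) + Hess W_x(Y, ♯Df)` at `x ∈ V` (metric compatibility of the Levi-Civita
connection; computation: `∂_Y[Df(♯DW)] = D²f(Y)(♯DW) + Df(∂_Y♯ DW) + Df(♯ D²W(Y))` with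
`∂_Y ♯ = −♯ ∂_Y G ♯`, `∂_Y G(v,w) = G(Γ_Y v, w) + G(v, Γ_Y w)`). The case `W = f` is
`IsMetricOn.hasFDerivAt_gradSqAt`. [cite: ONeill1983, Ch. 3, Prop. 3.13] -/
theorem IsMetricOn.hasFDerivAt_innerGrad (hG : IsMetricOn G V) (hx : x ∈ V)
    (hf : ContDiffOn ℝ ∞ f V) (hW : ContDiffOn ℝ ∞ W V) :
    HasFDerivAt (fun y ↦ fderiv ℝ f y (sharpAt G y (fderiv ℝ W y)))
      ((hessAt G f x).flip (sharpAt G x (fderiv ℝ W x))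
        + (hessAt G W x).flip (sharpAt G x (fderiv ℝ f x))) x := by
  have hi := hG.isInvertible x hx
  have hs := hG.symm x hx
  have hDf : DifferentiableAt ℝ (fderiv ℝ f) x :=
    (contDiffAt_fderiv_of_contDiffOn hG.isOpen hf hx).differentiableAt (by simp)
  have hDW : DifferentiableAt ℝ (fderiv ℝ W) x :=
    (contDiffAt_fderiv_of_contDiffOn hG.isOpen hW hx).differentiableAt (by simp)
  have hsh := hG.differentiableAt_sharpAt hx
  -- `y ↦ ♯_y (DW_y)`
  have hc : HasFDerivAt (fun y ↦ sharpAt G y (fderiv ℝ W y))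
      ((sharpAt G x).comp (fderiv ℝ (fderiv ℝ W) x) +
        (fderiv ℝ (sharpAt G) x).flip (fderiv ℝ W x)) x :=
    hsh.hasFDerivAt.clm_apply hDW.hasFDerivAt
  -- `y ↦ Df_y (♯_y DW_y)`
  have hprod : HasFDerivAt (fun y ↦ fderiv ℝ f y (sharpAt G y (fderiv ℝ W y)))
      ((fderiv ℝ f x).comp ((sharpAt G x).comp (fderiv ℝ (fderiv ℝ W) x) +
        (fderiv ℝ (sharpAt G) x).flip (fderiv ℝ W x)) +
        (fderiv ℝ (fderiv ℝ f) x).flip (sharpAt G x (fderiv ℝ W x))) x :=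
    hDf.hasFDerivAt.clm_apply hc
  refine hprod.congr_fderiv ?_
  ext Y
  simp only [_root_.add_apply, ContinuousLinearMap.comp_apply, flip_apply,
    hessAt_apply, hG.fderiv_sharpAt hx Y, _root_.neg_apply, map_add, map_neg]
  -- `Df(♯ α) = α(♯ Df)` for the symmetric `G x`
  have hswap : ∀ α : E →L[ℝ] ℝ, fderiv ℝ f x (sharpAt G x α) = α (sharpAt G x (fderiv ℝ f x)) := by
    intro α
    rw [← apply_sharpAt_apply hi (fderiv ℝ f x) (sharpAt G x α), hs, apply_sharpAt_apply hi]
  rw [hswap (fderiv ℝ (fderiv ℝ W) x Y),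
    hswap (fderiv ℝ G x Y (sharpAt G x (fderiv ℝ W x))), hG.fderiv_eq_chrAt hx Y,
    apply_sharpAt_apply hi, apply_apply_sharpAt hi hs]
  ring

omit [FiniteDimensional ℝ E] in
/-- `fderiv` form of `hasFDerivAt_innerGrad`:
`∂_Y ⟨∇f, ∇W⟩(x) = Hess f_x(Y, ♯DW_x) + Hess W_x(Y, ♯Df_x)`. [cite: ONeill1983, Ch. 3, Prop. 3.13] -/
theorem IsMetricOn.fderiv_innerGrad (hG : IsMetricOn G V) (hx : x ∈ V)
    (hf : ContDiffOn ℝ ∞ f V) (hW : ContDiffOn ℝ ∞ W V) (Y : E) :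
    fderiv ℝ (fun y ↦ fderiv ℝ f y (sharpAt G y (fderiv ℝ W y))) x Y =
      hessAt G f x Y (sharpAt G x (fderiv ℝ W x))
        + hessAt G W x Y (sharpAt G x (fderiv ℝ f x)) := by
  rw [(hG.hasFDerivAt_innerGrad hx hf hW).fderiv]
  simp

omit [FiniteDimensional ℝ E] in
/-- `⟨∇f, ∇W⟩` is differentiable at the points of `V`. [folklore] -/
theorem IsMetricOn.differentiableAt_innerGrad (hG : IsMetricOn G V) (hx : x ∈ V)
    (hf : ContDiffOn ℝ ∞ f V) (hW : ContDiffOn ℝ ∞ W V) :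
    DifferentiableAt ℝ (fun y ↦ fderiv ℝ f y (sharpAt G y (fderiv ℝ W y))) x :=
  (hG.hasFDerivAt_innerGrad hx hf hW).differentiableAt

/-! ### The weighted Bochner formula -/

/-- **The weighted Bochner formula in coordinates** (Bakry–Émery; the Bochner formula of
Topping 2006, Prop. 8.2.6, for the weighted Laplacian `L φ = Δφ − ⟨∇W, ∇φ⟩`): for `C^∞`
functions `f, W` on `V` and `x ∈ V`,

  `L|∇f|² = 2|Hess f|² + 2⟨∇f, ∇(Lf)⟩ + 2 (Ric + Hess W)(∇f, ∇f)`,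

where `L|∇f|² = lapAt G |∇f|² − D|∇f|²(♯DW)`, `⟨∇f, ∇(Lf)⟩ = D(Δf)(♯Df) − D⟨∇f, ∇W⟩(♯Df)`,
`∇f = ♯Df`. From `IsMetricOn.lapAt_gradSqAt` (`Δ|∇f|² = 2|Hess f|² + 2 D(Δf)(♯Df) + 2Ric(∇f,∇f)`),
`∂_Y|∇f|² = 2 Hess f(Y, ∇f)` and `∂_Y⟨∇f, ∇W⟩ = Hess f(Y, ∇W) + Hess W(Y, ∇f)`: the two
`Hess f(∇f, ∇W)` terms cancel. [cite: CarrilloNi2009, §3 (p. 8, Bochner type formula)] -/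
theorem IsMetricOn.weightedLapAt_gradSqAt (hG : IsMetricOn G V) (hx : x ∈ V)
    (hf : ContDiffOn ℝ ∞ f V) (hW : ContDiffOn ℝ ∞ W V) :
    lapAt G (gradSqAt G f) x - fderiv ℝ (gradSqAt G f) x (sharpAt G x (fderiv ℝ W x)) =
      2 * normSqAt G x (hessAt G f x)
      + 2 * (fderiv ℝ (lapAt G f) x (sharpAt G x (fderiv ℝ f x))
          - fderiv ℝ (fun y ↦ fderiv ℝ f y (sharpAt G y (fderiv ℝ W y))) x
              (sharpAt G x (fderiv ℝ f x)))
      + 2 * (ricAt G x (sharpAt G x (fderiv ℝ f x)) (sharpAt G x (fderiv ℝ f x))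
          + hessAt G W x (sharpAt G x (fderiv ℝ f x)) (sharpAt G x (fderiv ℝ f x))) := by
  rw [hG.lapAt_gradSqAt hx hf, hG.fderiv_gradSqAt hx hf, hG.fderiv_innerGrad hx hf hW,
    hG.hessAt_comm hx (contDiffAt_of_contDiffOn hG.isOpen hf hx)
      (sharpAt G x (fderiv ℝ W x)) (sharpAt G x (fderiv ℝ f x))]
  ring

end InnerGrad

/-! ### A static metric as a constant family; `∂_t |∇f_t|² = 2 Dḟ(♯Df)` -/

section Static

variable {S : Set ℝ} {t : ℝ} {f : ℝ → E → ℝ} {W : E → ℝ}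

omit [FiniteDimensional ℝ E] [CompleteSpace E] in
/-- A static metric on `V` is a (constant) smooth one-parameter family on `V × S` for every time
set `S` with unique derivatives and `S ⊆ closure (interior S)` (e.g. an interval), with
`∂G/∂t = 0`. [folklore] -/
theorem IsMetricOn.isMetricFamilyOn_const (hG : IsMetricOn G V) (hS : UniqueDiffOn ℝ S)
    (hS' : S ⊆ closure (interior S)) : IsMetricFamilyOn (fun _ : ℝ ↦ G) S V where
  isMetricOn _ _ := hG
  contDiffOn := hG.contDiffOn.comp contDiffOn_fst fun _ hp ↦ hp.1
  uniqueDiffOn := hS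
  subset_closure_interior := hS'

omit [FiniteDimensional ℝ E] [CompleteSpace E] in
/-- The time derivative of a constant family vanishes. [folklore] -/
theorem tDeriv_const (G : E → E →L[ℝ] E →L[ℝ] ℝ) (S : Set ℝ) (t : ℝ) (x : E) :
    tDeriv (fun _ : ℝ ↦ G) S t x = 0 := by
  simp only [tDeriv, derivWithin_fun_const, Pi.zero_apply]

omit [FiniteDimensional ℝ E] in
/-- **`∂_t |∇f_t|² = 2 Dḟ(♯Df)` for a static metric** (`hasDerivWithinAt_gradSqAt` with
`∂G/∂t = 0`). [cite: Topping2006, proof of Prop. 6.2.1] -/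
theorem IsMetricOn.hasDerivWithinAt_gradSqAt_static (hG : IsMetricOn G V) (hS : UniqueDiffOn ℝ S)
    (hS' : S ⊆ closure (interior S))
    (hf : ContDiffOn ℝ ∞ (fun p : E × ℝ ↦ f p.2 p.1) (V ×ˢ S)) (hx : x ∈ V) (ht : t ∈ S) :
    HasDerivWithinAt (fun s ↦ gradSqAt G (f s) x)
      (2 * fderiv ℝ (tDerivFun f S t) x (sharpAt G x (fderiv ℝ (f t) x))) S t := by
  have h := (hG.isMetricFamilyOn_const hS hS').hasDerivWithinAt_gradSqAt hf hx ht
  simp only [tDeriv_const, _root_.zero_apply, neg_zero, zero_add] at h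
  exact h

/-! ### The dissipation identity of the Fisher information, pointwise -/

/-- **The pointwise dissipation identity of the Bakry–Émery strategy** (the computation of
Carrillo–Ni 2009, §3, p. 8, for a static weighted manifold). Let `G` be static metric components
on `V`, `W` a `C^∞` weight on `V`, `f : ℝ → E → ℝ` `C^∞` on `V × S` (time derivative `ḟ`
within `S`), and suppose that at time `t ∈ S` the slice solves, on `V`,

  `ḟ = Lf − |∇f|²`,  `L φ = Δφ − ⟨∇W, ∇φ⟩`

(the equation satisfied by `f = −log u` when `u̇ = Lu`, `u > 0`). Then at every `x ∈ V`

  `∂_t|∇f|² − L|∇f|² + 2⟨∇f, ∇|∇f|²⟩ = −2|Hess f|² − 2 (Ric + Hess W)(∇f, ∇f)`,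

all quantities in coordinates (`gradSqAt`, `lapAt`, `hessAt`, `normSqAt`, `ricAt`, `♯ = sharpAt`).
Proof: `∂_t|∇f|² = 2Dḟ(♯Df)` (static metric), `Dḟ = D(Δf) − D⟨∇f,∇W⟩ − D|∇f|²` on `V`,
`D⟨∇f,∇W⟩(♯Df) = Hess f(∇f,∇W) + Hess W(∇f,∇f)`, and the weighted Bochner formula.
[cite: CarrilloNi2009, §3 (p. 8, computation of d/dt I_V)] -/
theorem IsMetricOn.fisher_identity (hG : IsMetricOn G V) (hS : UniqueDiffOn ℝ S)
    (hS' : S ⊆ closure (interior S))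
    (hf : ContDiffOn ℝ ∞ (fun p : E × ℝ ↦ f p.2 p.1) (V ×ˢ S)) (hW : ContDiffOn ℝ ∞ W V)
    (hx : x ∈ V) (ht : t ∈ S)
    (heq : ∀ y ∈ V, tDerivFun f S t y =
      lapAt G (f t) y - fderiv ℝ (f t) y (sharpAt G y (fderiv ℝ W y)) - gradSqAt G (f t) y) :
    derivWithin (fun s ↦ gradSqAt G (f s) x) S t
      - (lapAt G (gradSqAt G (f t)) x
          - fderiv ℝ (gradSqAt G (f t)) x (sharpAt G x (fderiv ℝ W x)))
      + 2 * fderiv ℝ (gradSqAt G (f t)) x (sharpAt G x (fderiv ℝ (f t) x)) =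
      -2 * normSqAt G x (hessAt G (f t) x)
        - 2 * (ricAt G x (sharpAt G x (fderiv ℝ (f t) x)) (sharpAt G x (fderiv ℝ (f t) x))
          + hessAt G W x (sharpAt G x (fderiv ℝ (f t) x)) (sharpAt G x (fderiv ℝ (f t) x))) := by
  have hft : ContDiffOn ℝ ∞ (f t) V := contDiffOn_of_family hf ht
  -- `∂_t |∇f|² = 2 Dḟ(♯Df)`
  rw [(hG.hasDerivWithinAt_gradSqAt_static hS hS' hf hx ht).derivWithin (hS t ht)]
  -- `Dḟ = D(Δf) − D⟨∇f, ∇W⟩ − D|∇f|²` at `x` (the equation holds on the open `V`)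
  have hev : tDerivFun f S t =ᶠ[𝓝 x] fun y ↦
      lapAt G (f t) y - fderiv ℝ (f t) y (sharpAt G y (fderiv ℝ W y)) - gradSqAt G (f t) y :=
    (hG.eventually_mem hx).mono fun y hy ↦ heq y hy
  have hΔ : DifferentiableAt ℝ (lapAt G (f t)) x :=
    ((hG.contDiffOn_lapAt hft x hx).contDiffAt (hG.mem_nhds hx)).differentiableAt (by simp)
  have hI : DifferentiableAt ℝ (fun y ↦ fderiv ℝ (f t) y (sharpAt G y (fderiv ℝ W y))) x :=
    hG.differentiableAt_innerGrad hx hft hW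
  have hg : DifferentiableAt ℝ (gradSqAt G (f t)) x := hG.differentiableAt_gradSqAt hx hft
  have hD : fderiv ℝ (tDerivFun f S t) x =
      fderiv ℝ (lapAt G (f t)) x
        - fderiv ℝ (fun y ↦ fderiv ℝ (f t) y (sharpAt G y (fderiv ℝ W y))) x
        - fderiv ℝ (gradSqAt G (f t)) x := by
    have hΔI : DifferentiableAt ℝ
        (fun y ↦ lapAt G (f t) y - fderiv ℝ (f t) y (sharpAt G y (fderiv ℝ W y))) x := hΔ.sub hI
    rw [hev.fderiv_eq, fderiv_fun_sub hΔI hg, fderiv_fun_sub hΔ hI]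
  rw [hD]
  simp only [sub_apply]
  rw [hG.fderiv_innerGrad hx hft hW, hG.weightedLapAt_gradSqAt hx hft hW,
    hG.fderiv_innerGrad hx hft hW]
  ring

end Static

end MetricCoord

end Literature.Geometry.Lorentzian

end
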